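import Literature.AlgebraicGeometry.Motives.NormMapInvariantMorphism
import Mathlib.CategoryTheory.Endomorphism
import Mathlib.Logic.Equiv.Fin.Rotate
import Mathlib.Algebra.Group.Commute.Units
import HarnessLib

/-!
# A finite morphism to `ℙᴸ` invariant under an automorphism of finite order of a projective scheme

Topic `Literature/AlgebraicGeometry/Motives` (theorems only; no definitions, no named facts).

For a projective `k`-scheme `X ↪ ℙᴹ_k` and an automorphism `f` of `X` of finite order `m`
(`fᵐ = 1`), there is a FINITE `k`-morphism `φ : X ⟶ ℙᴸ_k` with `f ≫ φ = φ`
(`exists_isFinite_comp_eq_of_pow_eq_one`). Classically `φ` is the composite of the quotient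
`X → X/⟨f⟩` with a projective embedding of `X/⟨f⟩` (Mumford, *Abelian Varieties* §7, Thm. p. 66 and
Remark p. 69: the quotient of a projective variety by a finite group is projective, by norms of
sections; Harris, *Algebraic Geometry*, Lecture 10); here it is the NORM MAP
(`Motives/NormMapInvariantMorphism`) of the family `r_i = fⁱ ≫ ι` (`i : Fin m`), which `f` permutes
cyclically, for a family of forms `F_α` of a common degree such that the charts
`⋂_i r_i⁻¹ D₊(F_α)` cover `X`. The existence of such forms (`exists_forms_iSup_iInf_eq_top`) is graded
prime avoidance — through the finitely many points `r_i(x)` of `ℙᴹ` passes the complement of some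
hypersurface `D₊(F_x)` (the tree's `GradedPrimeAvoidance.exists_form_basicOpen`; Görtz–Wedhorn I,
Prop. 13.49) — followed by quasi-compactness of `X` and equalisation of the degrees by powers.

Use (cell `hodge-nonav`, LIT-DOSSIER §65 L4): with the Bertini fact for finite morphisms
(`HodgeTheory.Hartshorne1977_bertini_finiteMorphism`) the general member `φ⁻¹(H)` is a smooth
`f`-STABLE hypersurface section of a smooth projective `X` (`HodgeTheory/FiniteMorphismHyperplaneSections`).

## References

* [MumfordAV1970] D. Mumford, *Abelian Varieties* (1970), §7, Theorem p. 66 and Remark p. 69.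
* [Harris1992] J. Harris, *Algebraic Geometry: A First Course*, Lecture 10.
* [GortzWedhorn2020] U. Görtz, T. Wedhorn, *Algebraic Geometry I*, 2nd ed., Prop. 13.49, Thm. 13.84.
* [Singh2011] B. Singh, *Basic Commutative Algebra*, 2.9.2 (graded prime avoidance).
-/

noncomputable section

universe u

open CategoryTheory AlgebraicGeometry Limits TopologicalSpace
open Literature.AlgebraicGeometry.Motives.Segre

namespace Literature.AlgebraicGeometry.Motives

attribute [local instance] MvPolynomial.gradedAlgebra

/-! ### Forms whose charts `⋂_i r_i⁻¹ D₊(F_α)` cover a quasi-compact scheme -/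

section Cover

variable {A : Type u} {σ : Type*} [CommRing A] [SetLike σ A] [AddSubgroupClass σ A]
  {𝒜 : ℕ → σ} [GradedRing 𝒜] {X : Scheme.{u}} {κ : Type} [Fintype κ] (r : κ → (X ⟶ Proj 𝒜))

omit [Fintype κ] in
/-- Membership in a finite intersection of opens. [folklore] -/
private theorem mem_iInf_iff [Finite κ] {U : κ → X.Opens} {x : X} : x ∈ (⨅ i, U i) ↔ ∀ i, x ∈ U i := by
  haveI := Fintype.ofFinite κ
  rw [← Finset.inf_univ_eq_iInf, ← SetLike.mem_coe, Opens.coe_finset_inf, Finset.inf_set_eq_iInter]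
  simp

omit [Fintype κ] in
/-- `D₊(Fᵉ) = D₊(F)` for `e > 0`. [folklore] -/
private theorem basicOpen_pow (F : A) {e : ℕ} (he : 0 < e) :
    Proj.basicOpen 𝒜 (F ^ e) = Proj.basicOpen 𝒜 F :=
  ProjectiveSpectrum.basicOpen_pow 𝒜 F e he

/-- **A form through finitely many points**: for `x ∈ X` there is a form `F` of positive degree
with `r_i(x) ∈ D₊(F)` for all `i` (graded prime avoidance at the finitely many relevant primes
`r_i(x)`; Görtz–Wedhorn I, Prop. 13.49). [cite: GortzWedhorn2020, Prop. 13.49] [cite: Singh2011, 2.9.2 (p. 39)] -/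
theorem exists_form_forall_mem_basicOpen (x : X) :
    ∃ (n : ℕ) (F : A), 0 < n ∧ F ∈ 𝒜 n ∧ ∀ i, (r i).base x ∈ Proj.basicOpen 𝒜 F := by
  classical
  obtain ⟨n, F, hn, hF, hT, -⟩ := GradedPrimeAvoidance.exists_form_basicOpen 𝒜 (𝟙 (Proj 𝒜))
    (fun _ _ h ↦ h) IsClosedMap.id (Finset.univ.image fun i ↦ (r i).base x) ⊤ (fun _ _ ↦ trivial)
  exact ⟨n, F, hn, hF, fun i ↦ hT _ (Finset.mem_image_of_mem _ (Finset.mem_univ i))⟩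

/-- **Forms of a common degree whose charts `⋂_i r_i⁻¹ D₊(F_α)` cover `X`**, for `X` quasi-compact
and a finite family of morphisms `r_i : X → Proj A`: pointwise forms (`exists_form_forall_mem_basicOpen`),
a finite subcover, and powers to equalise the degrees (`D₊(Fᵉ) = D₊(F)`). The hypothesis `hcov` of
the norm map `Motives.normMap`. [cite: GortzWedhorn2020, Prop. 13.49 and Prop. 13.47] -/
theorem exists_forms_iSup_iInf_eq_top [CompactSpace X] :
    ∃ (L d : ℕ) (F : Fin (L + 1) → A), 0 < d ∧ (∀ α, F α ∈ 𝒜 d) ∧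
      ⨆ α, (⨅ i, r i ⁻¹ᵁ Proj.basicOpen 𝒜 (F α)) = ⊤ := by
  classical
  choose n F hn hF hmem using exists_form_forall_mem_basicOpen r
  -- a finite subcover of the opens `W x = ⋂ i, r_i⁻¹ D₊(F x)`, `x ∈ W x`
  obtain ⟨t, -, ht⟩ := isCompact_univ.elim_nhds_subcover
    (fun x ↦ ((⨅ i, r i ⁻¹ᵁ Proj.basicOpen 𝒜 (F x) : X.Opens) : Set X))
    (fun x _ ↦ (⨅ i, r i ⁻¹ᵁ Proj.basicOpen 𝒜 (F x) : X.Opens).isOpen.mem_nhds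
      ((mem_iInf_iff).2 (hmem x)))
  -- equalise the degrees
  set d : ℕ := ∏ x ∈ t, n x with hd
  have hdpos : 0 < d := Finset.prod_pos fun x _ ↦ hn x
  have hdvd : ∀ x ∈ t, n x ∣ d := fun x hx ↦ Finset.dvd_prod_of_mem n hx
  have hediv : ∀ x ∈ t, 0 < d / n x := fun x hx ↦
    Nat.div_pos (Nat.le_of_dvd hdpos (hdvd x hx)) (hn x)
  -- the forms: `F_x ^ (d / n_x)` for `x ∈ t` (indexed by `Fin t.card`), and a junk zero form
  let G : Fin (t.card + 1) → A := fun α ↦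
    if h : (α : ℕ) < t.card then
      F (t.equivFin.symm ⟨α, h⟩) ^ (d / n (t.equivFin.symm ⟨α, h⟩)) else 0
  refine ⟨t.card, d, G, hdpos, fun α ↦ ?_, ?_⟩
  · by_cases h : (α : ℕ) < t.card
    · simp only [G, dif_pos h]
      have hy := (t.equivFin.symm ⟨α, h⟩).2
      have := SetLike.pow_mem_graded (d / n (t.equivFin.symm ⟨α, h⟩)) (hF (t.equivFin.symm ⟨α, h⟩))
      rwa [smul_eq_mul, Nat.div_mul_cancel (hdvd _ hy)] at this
    · simp only [G, dif_neg h]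
      exact zero_mem _
  · refine eq_top_iff.2 fun x _ ↦ ?_
    obtain ⟨y, hy, hxy⟩ := Set.mem_iUnion₂.1 (ht (Set.mem_univ x))
    let α : Fin (t.card + 1) := Fin.castSucc (t.equivFin ⟨y, hy⟩)
    have hα : (α : ℕ) < t.card := by simp [α]
    have hsymm : t.equivFin.symm ⟨α, hα⟩ = ⟨y, hy⟩ := by
      rw [Equiv.symm_apply_eq]
      ext
      simp [α]
    refine Opens.mem_iSup.2 ⟨α, ?_⟩
    have hG : G α = F y ^ (d / n y) := by
      simp only [G, dif_pos hα, hsymm]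
    rw [hG, basicOpen_pow _ (hediv y hy)]
    exact hxy

end Cover

/-! ### The invariant finite morphism -/

section Invariant

variable {k : Type u} [Field k] {X : SchemeOver k}

/-- `f ≫ fⁱ = f^{i+1}`, read through the cyclic shift of `Fin (n + 1)` when `f^{n+1} = 1`.
[cite: MumfordAV1970, §7 Thm. p. 66 (proof)] -/
theorem comp_pow_eq_pow_finRotate (f : X ⟶ X) {n : ℕ} (hf : End.of f ^ (n + 1) = 1)
    (i : Fin (n + 1)) :
    f ≫ (End.of f ^ (i : ℕ) : X ⟶ X) = (End.of f ^ ((finRotate (n + 1) i : ℕ)) : X ⟶ X) := by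
  change (End.of f ^ (i : ℕ) * End.of f : End X) = _
  rw [← pow_succ]
  by_cases hi : i = Fin.last n
  · subst hi
    rw [finRotate_last, Fin.val_last, Fin.val_zero, pow_zero, hf]
  · rw [coe_finRotate_of_ne_last hi]

/-- **An automorphism of finite order of a projective scheme admits an invariant FINITE morphism to
a projective space**: for `X` projective over `k` and `f : X ⟶ X` with `fᵐ = 1` (`m ≥ 1`) there are
`L` and a finite `k`-morphism `φ : X ⟶ ℙᴸ_k` with `f ≫ φ = φ` — the norm map of the family
`fⁱ ≫ ι` (`ι : X ↪ ℙᴹ` a projective embedding), which `f` permutes cyclically (Mumford AV §7: norms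
of sections; classically `X → X/⟨f⟩ ↪ ℙᴸ`). [cite: MumfordAV1970, §7 Thm. p. 66 and Remark p. 69] [cite: Harris1992, Lecture 10] -/
theorem exists_isFinite_comp_eq_of_pow_eq_one (hX : IsProjectiveOver X) (f : X ⟶ X) {m : ℕ}
    (hm : 0 < m) (hf : End.of f ^ m = 1) :
    ∃ (L : ℕ) (φ : X ⟶ projectiveSpace L k), IsFinite φ.left ∧ f ≫ φ = φ := by
  classical
  obtain ⟨n, rfl⟩ : ∃ n, m = n + 1 := ⟨m - 1, (Nat.succ_pred_eq_of_pos hm).symm⟩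
  haveI : IsProper X.hom := hX.isProper
  obtain ⟨M, ι, hι⟩ := hX
  haveI := hι
  haveI : CompactSpace ↥X.left := QuasiCompact.compactSpace_of_compactSpace X.hom
  -- the family `r i = fⁱ ≫ ι : X → ℙᴹ`
  let r : Fin (n + 1) → (X.left ⟶ Proj (grading (Fin (M + 1)) k)) :=
    fun i ↦ (End.of f ^ (i : ℕ) : X ⟶ X).left ≫ ι.left
  haveI : ∀ i, IsAffineHom (r i) := fun i ↦ by
    haveI : IsIso (End.of f ^ (i : ℕ) : X ⟶ X) :=
      (isUnit_iff_isIso _).1 ((IsUnit.of_pow_eq_one hf (Nat.succ_ne_zero n)).pow (i : ℕ))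
    haveI : IsIso (End.of f ^ (i : ℕ) : X ⟶ X).left :=
      inferInstanceAs (IsIso ((Over.forget _).map (End.of f ^ (i : ℕ) : X ⟶ X)))
    exact inferInstanceAs (IsAffineHom ((End.of f ^ (i : ℕ) : X ⟶ X).left ≫ ι.left))
  obtain ⟨L, d, F, hd, hF, hcov⟩ := exists_forms_iSup_iInf_eq_top r
  refine ⟨L, normMap r F hF hd hcov, isFinite_normMap_left r F hF hd hcov,
    comp_normMap_eq r F hF hd hcov f (finRotate (n + 1)) fun i ↦ ?_⟩
  change f.left ≫ ((End.of f ^ (i : ℕ) : X ⟶ X).left ≫ ι.left) =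
    (End.of f ^ ((finRotate (n + 1) i : ℕ)) : X ⟶ X).left ≫ ι.left
  rw [← Category.assoc, ← Over.comp_left, comp_pow_eq_pow_finRotate f hf i]

/-- The same for a smooth projective variety (`Motives.IsSmoothProjective`). [cite: MumfordAV1970, §7 Thm. p. 66 and Remark p. 69] -/
theorem IsSmoothProjective.exists_isFinite_comp_eq_of_pow_eq_one {n : ℕ} (hX : IsSmoothProjective n X)
    (f : X ⟶ X) {m : ℕ} (hm : 0 < m) (hf : End.of f ^ m = 1) :
    ∃ (L : ℕ) (φ : X ⟶ projectiveSpace L k), IsFinite φ.left ∧ f ≫ φ = φ :=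
  Motives.exists_isFinite_comp_eq_of_pow_eq_one hX.isProjectiveOver f hm hf

end Invariant

end Literature.AlgebraicGeometry.Motives

end
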